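import Summits.QuantumFields.QCD.Theses.NestedDissectionSea
import Literature.MathematicalPhysics.QuantumLattice.WilsonPositivityDomain

/-!
# Crux `NegativeCellsDilute` (stmt-QuantumFields-13900), negative side — Dirichlet-cell positivity
# at positive bare mass; the pin-less crux is trivially true

Support file of the standing disprover (refuter-cdisprove-stmt-QuantumFields-13900-0), companion of
`PinWindow.lean`. Proved here (sorry-free, standard axioms):

* `block_det_im`: EVERY principal minor of `D_W(U, μ, 1)` (any predicate on site × colour × spin,
  any unitary colour representation, any torus) is real — γ₅-hermiticity restricted, `Γ₅` being
  diagonal (route item `DirichletDetReal` is the site-set special case; a candidate proof is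
  attached to stmt-QuantumFields-11275);
* `block_det_re_pos`: … and strictly positive for `μ > 0` (numerical range of the hopping
  `Re x†(1 − cK)x ≥ (1 − 4c)‖x‖²` for `K = Σ_ν W_ν`, four isometries; zero-extension of block kernel
  vectors; IVT along the hopping homotopy);
* `not_isSignDefect_of_pos`: at a positive valence mass no box is a sign defect (any scale);
* `negativeCellsDilute_without_pin`: the crux with its pin clause (b) DELETED (rest verbatim,
  certified by `without_pin_of_crux`) holds along the heavy junk regularisation `mcrit ≡ 1`.

Reading for provers: the pin (b) is the SOLE carrier of content of the crux.
-/

noncomputable section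

namespace Summit.QuantumFields.QCD.Theorems.NegativeCellsDiluteCellPositivity


open MeasureTheory Filter Matrix
open Literature.MathematicalPhysics.QuantumLattice Literature.MathematicalPhysics.QuantumFieldTheory
  Literature.Probability.LatticeModels


/-- The fundamental representation of `SU(3)` is unitary (tree). [folklore] -/
theorem fund_unitary : ∀ g : (Matrix.specialUnitaryGroup (Fin 3) ℂ), fundamentalRep (Fin 3) g ∈ Matrix.unitaryGroup (Fin 3) ℂ :=
  fun g => fundamentalRep_mem_unitaryGroup g

section HopRescale

variable {L N : ℕ} {G : Type*} [Group G] (ρ : G →* Matrix (Fin N) (Fin N) ℂ)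

/-- For `t > 0` the hopping homotopy matrix is a rescaled Wilson–Dirac matrix at bare mass
`(m+4)/t − 4` (only `m + 4 ≠ 0` is needed). [folklore] -/
theorem segMatrix_eq_smul_wilsonDirac_ne (hρ : ∀ g, ρ g ∈ Matrix.unitaryGroup (Fin N) ℂ)
    (U : GaugeConfig 4 L G) {m t : ℝ} (hm : m + 4 ≠ 0) (ht : 0 < t) :
    (1 - ((t / (m + 4) : ℝ) : ℂ) • ∑ μ, wilsonHop ρ U μ) =
      ((t / (m + 4) : ℝ) : ℂ) • wilsonDirac ρ U ((m + 4) / t - 4) 1 := by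
  rw [wilsonDirac_eq_sub_sum_wilsonHop ρ hρ, smul_sub, smul_smul, ← Complex.ofReal_mul,
    show t / (m + 4) * ((m + 4) / t - 4 + 4) = 1 by field_simp; ring, Complex.ofReal_one,
    one_smul]

end HopRescale

/-! ## Dirichlet-cell reality and positivity at positive bare mass -/

section CellPositivity

variable {L N : ℕ} [NeZero L] {G : Type*} [Group G] (ρ : G →* Matrix (Fin N) (Fin N) ℂ)

omit [NeZero L] in
/-- `γ₅² = 1` entrywise (the `γ₅` sign of a Wilson index is `±1`). [folklore] -/
theorem g5sign_mul_self (q : TorusSite 4 L × Fin N × Fin 4) :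
    (![1, 1, -1, -1] : Fin 4 → ℂ) q.2.2 * (![1, 1, -1, -1] : Fin 4 → ℂ) q.2.2 = 1 := by
  obtain ⟨x, a, α⟩ := q
  fin_cases α <;> simp

/-- **γ₅-hermiticity of every principal submatrix**: `(D|_p)ᴴ = Γ₅|_p · D|_p · Γ₅|_p`. [folklore] -/
theorem block_conjTranspose (hρ : ∀ g, ρ g ∈ Matrix.unitaryGroup (Fin N) ℂ)
    (U : GaugeConfig 4 L G) (μ : ℝ) (p : TorusSite 4 L × Fin N × Fin 4 → Prop) [DecidablePred p] :
    (toSquareBlockProp (wilsonDirac ρ U μ 1) p)ᴴ =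
      diagonal (fun i : {a // p a} => (![1, 1, -1, -1] : Fin 4 → ℂ) i.1.2.2) *
        toSquareBlockProp (wilsonDirac ρ U μ 1) p *
          diagonal (fun i : {a // p a} => (![1, 1, -1, -1] : Fin 4 → ℂ) i.1.2.2) := by
  have hΓ := wilsonDirac_gammaFive_hermitian_holds (L := L) ρ hρ U μ 1
  rw [spinorLift_gammaFive_eq_diagonal] at hΓ
  ext i j
  have hij := congrFun (congrFun hΓ i.1) j.1
  rw [mul_diagonal, diagonal_mul, conjTranspose_apply] at hij
  rw [mul_diagonal, diagonal_mul, conjTranspose_apply]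
  simp only [toSquareBlockProp_def, of_apply]
  rw [← hij]

/-- **Route item `DirichletDetReal`, for every predicate**: principal-minor determinants of the
Wilson–Dirac matrix are real. [folklore] -/
theorem block_det_im (hρ : ∀ g, ρ g ∈ Matrix.unitaryGroup (Fin N) ℂ)
    (U : GaugeConfig 4 L G) (μ : ℝ) (p : TorusSite 4 L × Fin N × Fin 4 → Prop) [DecidablePred p] :
    (toSquareBlockProp (wilsonDirac ρ U μ 1) p).det.im = 0 := by
  set C := toSquareBlockProp (wilsonDirac ρ U μ 1) p
  have h := congrArg Matrix.det (block_conjTranspose ρ hρ U μ p)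
  rw [det_conjTranspose, det_mul, det_mul, det_diagonal] at h
  have hprod : (∏ i : {a // p a}, (![1, 1, -1, -1] : Fin 4 → ℂ) i.1.2.2) * ∏ i : {a // p a}, (![1, 1, -1, -1] : Fin 4 → ℂ) i.1.2.2 = 1 := by
    rw [← Finset.prod_mul_distrib]
    simp [g5sign_mul_self]
  have hfix : star C.det = C.det := by
    rw [h]
    calc (∏ i : {a // p a}, (![1, 1, -1, -1] : Fin 4 → ℂ) i.1.2.2) * C.det * ∏ i : {a // p a}, (![1, 1, -1, -1] : Fin 4 → ℂ) i.1.2.2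
        = C.det * ((∏ i : {a // p a}, (![1, 1, -1, -1] : Fin 4 → ℂ) i.1.2.2) * ∏ i : {a // p a}, (![1, 1, -1, -1] : Fin 4 → ℂ) i.1.2.2) := by ring
      _ = C.det := by rw [hprod, mul_one]
  exact Complex.conj_eq_iff_im.mp hfix

omit [NeZero L] in
/-- `Re (x† x) ≥ 0`. [folklore] -/
theorem re_star_dotProduct_self_nonneg {n : Type*} [Fintype n] (y : n → ℂ) :
    0 ≤ (star y ⬝ᵥ y).re := by
  rw [dotProduct, Complex.re_sum]
  refine Finset.sum_nonneg fun i _ => ?_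
  rw [Pi.star_apply, Complex.star_def, mul_comm, Complex.mul_conj, Complex.ofReal_re]
  exact Complex.normSq_nonneg _

omit [NeZero L] in
/-- `Re (x† x) > 0` for `x ≠ 0`. [folklore] -/
theorem re_star_dotProduct_self_pos {n : Type*} [Fintype n] {y : n → ℂ} (hy : y ≠ 0) :
    0 < (star y ⬝ᵥ y).re := by
  rw [dotProduct, Complex.re_sum]
  obtain ⟨i, hi⟩ : ∃ i, y i ≠ 0 := Function.ne_iff.mp hy
  refine Finset.sum_pos' (fun j _ => ?_) ⟨i, Finset.mem_univ _, ?_⟩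
  · rw [Pi.star_apply, Complex.star_def, mul_comm, Complex.mul_conj, Complex.ofReal_re]
    exact Complex.normSq_nonneg _
  · rw [Pi.star_apply, Complex.star_def, mul_comm, Complex.mul_conj, Complex.ofReal_re]
    exact Complex.normSq_pos.mpr hi

omit [NeZero L] in
/-- For an isometry `W` (`Wᴴ W = 1`): `Re (x† W x) ≤ x† x` (expand `‖Wx − x‖² ≥ 0`). [folklore] -/
theorem re_star_dotProduct_isometry_le {n : Type*} [Fintype n] [DecidableEq n]
    (W : Matrix n n ℂ) (hW : Wᴴ * W = 1) (x : n → ℂ) :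
    (star x ⬝ᵥ (W *ᵥ x)).re ≤ (star x ⬝ᵥ x).re := by
  have h0 := re_star_dotProduct_self_nonneg (W *ᵥ x - x)
  have h1 : star (W *ᵥ x) ⬝ᵥ (W *ᵥ x) = star x ⬝ᵥ x := by
    rw [star_mulVec, ← dotProduct_mulVec, mulVec_mulVec, hW, one_mulVec]
  have h2 : star (W *ᵥ x) ⬝ᵥ x = star (star x ⬝ᵥ (W *ᵥ x)) := by
    rw [star_dotProduct]
  have hexp : star (W *ᵥ x - x) ⬝ᵥ (W *ᵥ x - x) =
      star x ⬝ᵥ x - star (star x ⬝ᵥ (W *ᵥ x)) - star x ⬝ᵥ (W *ᵥ x) + star x ⬝ᵥ x := by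
    rw [star_sub, sub_dotProduct, dotProduct_sub, dotProduct_sub, h1, h2]
    ring
  rw [hexp] at h0
  simp only [Complex.add_re, Complex.sub_re, Complex.star_def, Complex.conj_re] at h0
  linarith

/-- **Numerical range of the hopping homotopy**: for `c ≥ 0`,
`Re (x† (1 − cK) x) ≥ (1 − 4c) · x† x`, `K = Σ_ν W_ν` the Wilson hopping (four isometries). [folklore] -/
theorem re_form_segMatrix_ge (hρ : ∀ g, ρ g ∈ Matrix.unitaryGroup (Fin N) ℂ)
    (U : GaugeConfig 4 L G) (x : TorusSite 4 L × Fin N × Fin 4 → ℂ) {c : ℝ} (hc : 0 ≤ c) :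
    (1 - 4 * c) * (star x ⬝ᵥ x).re ≤
      (star x ⬝ᵥ ((1 - (c : ℂ) • ∑ ν, wilsonHop ρ U ν) *ᵥ x)).re := by
  have hsum : (∑ ν, wilsonHop ρ U ν) *ᵥ x = ∑ ν, wilsonHop ρ U ν *ᵥ x := Matrix.sum_mulVec _ _ _
  have hform : star x ⬝ᵥ ((1 - (c : ℂ) • ∑ ν, wilsonHop ρ U ν) *ᵥ x) =
      star x ⬝ᵥ x - (c : ℂ) * ∑ ν, star x ⬝ᵥ (wilsonHop ρ U ν *ᵥ x) := by
    rw [sub_mulVec, one_mulVec, smul_mulVec, hsum, dotProduct_sub, dotProduct_smul,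
      dotProduct_sum, smul_eq_mul]
  rw [hform, Complex.sub_re, Complex.re_ofReal_mul, Complex.re_sum]
  have hb : ∑ ν : Fin 4, (star x ⬝ᵥ (wilsonHop ρ U ν *ᵥ x)).re ≤ ∑ _ν : Fin 4, (star x ⬝ᵥ x).re :=
    Finset.sum_le_sum fun ν _ =>
      re_star_dotProduct_isometry_le _ (conjTranspose_mul_wilsonHop ρ hρ U ν) x
  have h4 : ∑ _ν : Fin 4, (star x ⬝ᵥ x).re = 4 * (star x ⬝ᵥ x).re := by simp [Finset.sum_const]
  rw [h4] at hb
  nlinarith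

omit [NeZero L] in
/-- Zero-extension of a block vector: the quadratic form of a principal submatrix is the
quadratic form of the full matrix on the extension, and the norms agree. [folklore] -/
theorem block_form_eq_extend {n : Type*} [Fintype n] (A : Matrix n n ℂ) (p : n → Prop)
    [DecidablePred p] (v : {a // p a} → ℂ) :
    let x : n → ℂ := fun i => if h : p i then v ⟨i, h⟩ else 0
    star v ⬝ᵥ (toSquareBlockProp A p *ᵥ v) = star x ⬝ᵥ (A *ᵥ x) ∧
      star v ⬝ᵥ v = star x ⬝ᵥ x := by
  intro x
  have hx : ∀ i : {a // p a}, x i.1 = v i := fun i => by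
    simp only [x, dif_pos i.2]
  have hx' : ∀ i : {a // ¬ p a}, x i.1 = 0 := fun i => by
    simp only [x, dif_neg i.2]
  have hAx : ∀ i : n, (A *ᵥ x) i = ∑ j : {a // p a}, A i j.1 * v j := by
    intro i
    rw [mulVec, dotProduct, ← Fintype.sum_subtype_add_sum_subtype p (fun j => A i j * x j)]
    simp [hx, hx']
  constructor
  · rw [dotProduct, dotProduct, ← Fintype.sum_subtype_add_sum_subtype p (fun i => star x i * (A *ᵥ x) i)]
    simp only [Pi.star_apply, hx, hx', star_zero, zero_mul, Finset.sum_const_zero, add_zero, hAx]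
    rfl
  · rw [dotProduct, dotProduct, ← Fintype.sum_subtype_add_sum_subtype p (fun i => star x i * x i)]
    simp only [Pi.star_apply, hx, hx', star_zero, zero_mul, Finset.sum_const_zero, add_zero]

/-- The hopping homotopy restricted to a block is injective for `0 ≤ c < 1/4`, hence has non-zero
determinant. [folklore] -/
theorem block_segMatrix_det_ne_zero (hρ : ∀ g, ρ g ∈ Matrix.unitaryGroup (Fin N) ℂ)
    (U : GaugeConfig 4 L G) (p : TorusSite 4 L × Fin N × Fin 4 → Prop) [DecidablePred p]
    {c : ℝ} (hc : 0 ≤ c) (hc4 : 4 * c < 1) :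
    (toSquareBlockProp (1 - (c : ℂ) • ∑ ν, wilsonHop ρ U ν) p).det ≠ 0 := by
  intro hdet
  obtain ⟨v, hv, hAv⟩ := Matrix.exists_mulVec_eq_zero_iff.mpr hdet
  obtain ⟨hform, -⟩ := block_form_eq_extend (1 - (c : ℂ) • ∑ ν, wilsonHop ρ U ν) p v
  set x : TorusSite 4 L × Fin N × Fin 4 → ℂ := fun i => if h : p i then v ⟨i, h⟩ else 0 with hxdef
  have hxne : x ≠ 0 := by
    intro hx0
    apply hv
    funext i
    have := congrFun hx0 i.1
    simp only [hxdef, dif_pos i.2, Pi.zero_apply] at this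
    exact this
  have hpos := re_star_dotProduct_self_pos hxne
  have hge := re_form_segMatrix_ge ρ hρ U x hc
  rw [← hform, hAv, dotProduct_zero, Complex.zero_re] at hge
  nlinarith

omit [NeZero L] in
/-- Restriction to a block commutes with scalars. [folklore] -/
theorem toSquareBlockProp_smul {n : Type*} (c : ℂ) (M : Matrix n n ℂ) (p : n → Prop) :
    toSquareBlockProp (c • M) p = c • toSquareBlockProp M p := rfl

omit [NeZero L] in
/-- Restriction of the identity matrix to a block is the identity. [folklore] -/
theorem toSquareBlockProp_one {n : Type*} [Fintype n] [DecidableEq n] (p : n → Prop) :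
    toSquareBlockProp (1 : Matrix n n ℂ) p = 1 :=
  submatrix_one _ Subtype.val_injective

/-- **Seiler positivity for Dirichlet cells / every principal submatrix**: for bare mass `μ > 0`,
`Re det (D_W(U, μ, 1)|_p) > 0` (and the determinant is real, `block_det_im`). [folklore] -/
theorem block_det_re_pos (hρ : ∀ g, ρ g ∈ Matrix.unitaryGroup (Fin N) ℂ)
    (U : GaugeConfig 4 L G) {μ : ℝ} (hμ : 0 < μ) (p : TorusSite 4 L × Fin N × Fin 4 → Prop)
    [DecidablePred p] :
    0 < (toSquareBlockProp (wilsonDirac ρ U μ 1) p).det.re := by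
  have hμ4 : 0 < μ + 4 := by linarith
  have hμ0 : μ + 4 ≠ 0 := hμ4.ne'
  -- the homotopy on the block
  set g : ℝ → ℝ := fun t =>
    ((toSquareBlockProp (1 - ((t / (μ + 4) : ℝ) : ℂ) • ∑ ν, wilsonHop ρ U ν) p).det).re with hgdef
  have hg : Continuous g := by
    refine Complex.continuous_re.comp ?_
    refine Continuous.matrix_det ?_
    exact (continuous_const.sub
      ((Complex.continuous_ofReal.comp (continuous_id.div_const (μ + 4))).smul
        continuous_const)).matrix_submatrix _ _
  have hg0 : g 0 = 1 := by
    simp [hgdef, toSquareBlockProp_one]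
  -- reality along the path
  have him : ∀ t : ℝ, 0 ≤ t →
      ((toSquareBlockProp (1 - ((t / (μ + 4) : ℝ) : ℂ) • ∑ ν, wilsonHop ρ U ν) p).det).im = 0 := by
    intro t ht0
    rcases ht0.eq_or_lt with h | ht
    · subst h; simp [toSquareBlockProp_one]
    · rw [segMatrix_eq_smul_wilsonDirac_ne ρ hρ U hμ0 ht, toSquareBlockProp, toBlock,
        submatrix_smul, Pi.smul_apply, Pi.smul_apply, det_smul]
      have hreal := block_det_im ρ hρ U ((μ + 4) / t - 4) p
      rw [toSquareBlockProp, toBlock] at hreal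
      set d := ((wilsonDirac ρ U ((μ + 4) / t - 4) 1).submatrix Subtype.val Subtype.val :
        Matrix {a // p a} {a // p a} ℂ).det with hd
      have hd' : d = ((d.re : ℝ) : ℂ) := Complex.ext (by simp) (by simpa using hreal)
      rw [hd', ← Complex.ofReal_pow, ← Complex.ofReal_mul, Complex.ofReal_im]
  have hne : ∀ t ∈ Set.Icc (0 : ℝ) 1, g t ≠ 0 := by
    intro t ht h0
    have hc : 0 ≤ t / (μ + 4) := div_nonneg ht.1 hμ4.le
    have hc4 : 4 * (t / (μ + 4)) < 1 := by
      rw [mul_div_assoc', div_lt_one hμ4]; linarith [ht.2]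
    apply block_segMatrix_det_ne_zero ρ hρ U p hc hc4
    exact Complex.ext (by simpa [hgdef] using h0) (by simpa using him t ht.1)
  have hg1 : 0 < g 1 := by
    refine lt_of_not_ge fun hle => ?_
    have hmem : (0 : ℝ) ∈ Set.Icc (g 1) (g 0) := ⟨hle, by rw [hg0]; norm_num⟩
    obtain ⟨t, ht, ht0⟩ := intermediate_value_Icc' zero_le_one hg.continuousOn hmem
    exact hne t ht ht0
  have hD : toSquareBlockProp (wilsonDirac ρ U μ 1) p =
      ((μ + 4 : ℝ) : ℂ) • toSquareBlockProp (1 - ((1 / (μ + 4) : ℝ) : ℂ) • ∑ ν, wilsonHop ρ U ν) p := by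
    rw [← toSquareBlockProp_smul, smul_sub, smul_smul,
      ← Complex.ofReal_mul, show (μ + 4) * (1 / (μ + 4)) = 1 by field_simp, Complex.ofReal_one,
      one_smul, wilsonDirac_eq_sub_sum_wilsonHop ρ hρ]
  have hdet : (toSquareBlockProp (wilsonDirac ρ U μ 1) p).det =
      (((μ + 4) ^ Fintype.card {a // p a} * g 1 : ℝ) : ℂ) := by
    rw [hD, det_smul]
    have him1 := him 1 zero_le_one
    set d := (toSquareBlockProp (1 - ((1 / (μ + 4) : ℝ) : ℂ) • ∑ ν, wilsonHop ρ U ν) p).det with hd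
    have hd' : d = ((d.re : ℝ) : ℂ) := Complex.ext (by simp) (by simpa using him1)
    rw [hd', ← Complex.ofReal_pow, ← Complex.ofReal_mul]
  rw [hdet, Complex.ofReal_re]
  exact mul_pos (pow_pos hμ4 _) hg1

end CellPositivity

/-! ### Consequences for the crux vocabulary -/

/-- At positive bare mass every Dirichlet cell determinant is positive. [folklore] -/
theorem cellDetRe_pos {N : ℕ} [NeZero N] (U : GaugeConfig 4 N (Matrix.specialUnitaryGroup (Fin 3) ℂ)) {μ : ℝ} (hμ : 0 < μ)
    (x : TorusSite 4 N) (s : Fin 4 → ℕ) : 0 < cellDetRe U μ x s :=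
  block_det_re_pos (fundamentalRep (Fin 3)) fund_unitary U hμ (wilsonBox x s)

/-- Hence NO box is a sign defect at a positive valence mass (any scale `j`). [folklore] -/
theorem not_isSignDefect_of_pos {N : ℕ} [NeZero N] (U : GaugeConfig 4 N (Matrix.specialUnitaryGroup (Fin 3) ℂ)) {μ : ℝ} (hμ : 0 < μ)
    (j : ℕ) (s : Fin 4 → ℕ) : ¬ IsSignDefect U μ j s := by
  rintro (⟨-, h⟩ | ⟨-, h⟩)
  · exact absurd h (not_lt.mpr (cellDetRe_pos U hμ 0 s).le)
  · have hp : 0 < cellDetRe U μ 0 s * ∏ ε : Fin 4 → Bool, cellDetRe U μ (halfCorner s ε) (halfSides s ε) :=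
      mul_pos (cellDetRe_pos U hμ 0 s) (Finset.prod_pos fun ε _ => cellDetRe_pos U hμ _ _)
    exact absurd h (not_lt.mpr hp.le)

/-! ### The pin-less crux holds trivially -/

section WithoutPin

open scoped Classical

/-- **Triviality of the pin-less crux.** `NegativeCellsDilute` with its pin clause (b) DELETED
(everything else VERBATIM) holds by the heavy junk witness: all valence masses are `> 0`, no box is
ever a sign defect (`not_isSignDefect_of_pos`), `δ ≡ 0`. So clause (b) is the ONLY clause standing
between the crux and a junk proof; every genuine proof passes through the parity pin. [folklore] -/
theorem negativeCellsDilute_without_pin :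
    ∀ Nf : ℕ, (Nf = 2 ∨ Nf = 3) → ∃ reg : QCDRegularisation Nf, reg.HasMassScaling ∧ (reg.scheme 0 0 0).HasAsymptoticScaling ∧ ∃ M₀ : ℝ, 0 ≤ M₀ ∧ ∃ b₀ : ℕ, 2 ≤ b₀ ∧ ∃ ℓ : ℝ, 0 < ℓ ∧ ∀ m : Fin Nf → ℝ, (∀ f, M₀ < m f) → ∃ R : ℝ, 0 < R ∧ (∀ ε : ℝ, 0 < ε → ∀ᶠ k : ℕ in Filter.atTop, ∀ S : ℕ, R ≤ reg.a k * (2 * S + 1) → let N : ℕ := 2 * S + 1; let mq : Fin Nf → ℝ := fun f => reg.mcrit k + reg.a k * m f / reg.Zm k; let wt : GaugeConfig 4 N (Matrix.specialUnitaryGroup (Fin 3) ℂ) → ℝ := fun U => ∏ f, ‖fermionDet (wilsonDirac (fundamentalRep (Fin 3)) U (mq f) 1)‖; let P : (GaugeConfig 4 N (Matrix.specialUnitaryGroup (Fin 3) ℂ) → Prop) → ℝ := fun E => (∫ U, (if E U then (1 : ℝ) else 0) * wt U ∂(wilsonMeasure (d := 4) (L := N) (fundamentalRep (Fin 3)) (reg.β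 k))) / (∫ U, wt U ∂(wilsonMeasure (d := 4) (L := N) (fundamentalRep (Fin 3)) (reg.β k))); let J : ℕ := Nat.log 2 (⌊ℓ / reg.a k⌋₊ / b₀) + 1; ∃ δ : ℕ → ℝ, ∑ j ∈ Finset.range J, δ j ≤ ε ∧ ∀ j < J, ∀ s : Fin 4 → ℕ, (∀ i, b₀ * 2 ^ j ≤ s i ∧ s i < b₀ * 2 ^ (j + 2) ∧ s i ≤ N ∧ (s i : ℝ) * reg.a k ≤ ℓ) → P (fun U => ∃ f, IsSignDefect U (mq f) j s) ≤ δ j) := by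
  intro Nf hNf
  -- the HEAVY junk regularisation: `canonicalAF` (a_k = 1/(k+1), two-loop β_k, canonical Z_m)
  -- with m_crit ≡ 1 — every valence mass is positive (κ < 1/8)
  let reg : QCDRegularisation Nf := { QCDRegularisation.canonicalAF Nf with mcrit := fun _ => 1 }
  have hms : reg.HasMassScaling := QCDRegularisation.canonicalAF_hasMassScaling
  have has : (reg.scheme 0 0 0).HasAsymptoticScaling := QCDScheme.zeroAF_hasAsymptoticScaling
  refine ⟨reg, hms, has, 0, le_rfl, 2, le_rfl, 1, one_pos, fun m hm => ⟨1, one_pos, ?_⟩⟩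
  intro ε hε
  refine Filter.Eventually.of_forall fun k S _ => ?_
  intro N mq wt P J
  refine ⟨fun _ => 0, by simp [hε.le], ?_⟩
  intro j _ s _
  have hpos : ∀ f, 0 < mq f := by
    intro f
    show 0 < reg.mcrit k + reg.a k * m f / reg.Zm k
    have h1 : reg.mcrit k = 1 := rfl
    have h2 : 0 ≤ reg.a k * m f / reg.Zm k :=
      div_nonneg (mul_nonneg (reg.a_pos k).le (hm f).le) (reg.Zm_pos k).le
    linarith
  have hE : ∀ U : GaugeConfig 4 N (Matrix.specialUnitaryGroup (Fin 3) ℂ), ¬ ∃ f, IsSignDefect U (mq f) j s :=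
    fun U ⟨f, hf⟩ => not_isSignDefect_of_pos U (hpos f) j s hf
  simp only [P]
  simp [hE]

/-- The crux projects onto the pin-less statement (certifies that the deleted-pin text above is
VERBATIM the rest of the crux). [folklore] -/
theorem without_pin_of_crux (h : Theses.NestedDissectionSea.NegativeCellsDilute) :
    ∀ Nf : ℕ, (Nf = 2 ∨ Nf = 3) → ∃ reg : QCDRegularisation Nf, reg.HasMassScaling ∧ (reg.scheme 0 0 0).HasAsymptoticScaling ∧ ∃ M₀ : ℝ, 0 ≤ M₀ ∧ ∃ b₀ : ℕ, 2 ≤ b₀ ∧ ∃ ℓ : ℝ, 0 < ℓ ∧ ∀ m : Fin Nf → ℝ, (∀ f, M₀ < m f) → ∃ R : ℝ, 0 < R ∧ (∀ ε : ℝ, 0 < ε → ∀ᶠ k : ℕ in Filter.atTop, ∀ S : ℕ, R ≤ reg.a k * (2 * S + 1) → let N : ℕ := 2 * S + 1; let mq : Fin Nf → ℝ := fun f => reg.mcrit k + reg.a k * m f / reg.Zm k; let wt : GaugeConfig 4 N (Matrix.specialUnitaryGroup (Fin 3) ℂ) → ℝ := fun U => ∏ f, ‖fermionDet (wilsonDirac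 (fundamentalRep (Fin 3)) U (mq f) 1)‖; let P : (GaugeConfig 4 N (Matrix.specialUnitaryGroup (Fin 3) ℂ) → Prop) → ℝ := fun E => (∫ U, (if E U then (1 : ℝ) else 0) * wt U ∂(wilsonMeasure (d := 4) (L := N) (fundamentalRep (Fin 3)) (reg.β k))) / (∫ U, wt U ∂(wilsonMeasure (d := 4) (L := N) (fundamentalRep (Fin 3)) (reg.β k))); let J : ℕ := Nat.log 2 (⌊ℓ / reg.a k⌋₊ / b₀) + 1; ∃ δ : ℕ → ℝ, ∑ j ∈ Finset.range J, δ j ≤ ε ∧ ∀ j < J, ∀ s : Fin 4 → ℕ, (∀ i, b₀ * 2 ^ j ≤ s i ∧ s i < b₀ * 2 ^ (j + 2) ∧ s i ≤ N ∧ (s i : ℝ) * reg.a k ≤ ℓ) → P (fun U => ∃ f, IsSignDefect U (mq f) j s) ≤ δ j) := by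
  intro Nf hNf
  obtain ⟨reg, h1, h2, M₀, hM₀, b₀, hb₀, ℓ, hℓ, h⟩ := h Nf hNf
  refine ⟨reg, h1, h2, M₀, hM₀, b₀, hb₀, ℓ, hℓ, fun m hm => ?_⟩
  obtain ⟨R, hR, ha, -⟩ := h m hm
  exact ⟨R, hR, ha⟩

end WithoutPin

end Summit.QuantumFields.QCD.Theorems.NegativeCellsDiluteCellPositivity

end
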